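import Literature.NumberTheory.CubicFields.CubicFieldCountForms
import Literature.NumberTheory.CubicFields.ReducibleMaximalCount
import Literature.NumberTheory.CubicFields.SubringForms
import Mathlib.Data.ZMod.Basic
import HarnessLib

/-!
# Finiteness of the number of `GL₂(ℤ)`-orbits of integral binary cubic forms of given nonzero discriminant

Topic `Literature/NumberTheory/CubicFields`; the junction of `CubicFieldCountForms.lean`
(orbits of maximal irreducible forms with bounded discriminant are finite — Hermite, through the
cubic fields), `ReducibleMaximalCount.lean` (orbits of maximal reducible forms with bounded
discriminant are finite — one per fundamental discriminant) and `SubringForms.lean` (every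
nondegenerate `R(f)` embeds with finite index in a maximal `R(g)`, `Disc f = D² Disc g`).

Bhargava–Taniguchi–Thorne 2023, §2.4 (11)–(12): the Shintani zeta functions
`ξ^±(s) = Σ_{x ∈ GL₂(ℤ)\V(ℤ), ±Disc(x) > 0} |Stab(x)|⁻¹ |Disc(x)|^{-s} = Σ_n a^±(n) n^{-s}` and (22)
`h(n)` = the number of `GL₂(ℤ)`-orbits of discriminant `n` presuppose that **for each `n ≠ 0` there
are only finitely many `GL₂(ℤ)`-orbits of integral binary cubic forms of discriminant `n`**
(classically: Hermite / Davenport's reduction theory). This file proves that finiteness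
algebraically, through the Levi–Delone–Faddeev correspondence:

* `maximalOrbits_finite` — finitely many orbits of MAXIMAL forms `g` with `0 < |Disc g| ≤ B`;
* `orbitsOfDisc D`, **`orbitsOfDisc_finite`** — for `D ≠ 0` the set of orbits of forms of
  discriminant `D` is finite: the orbit of `f` is determined by (the orbit of) its maximal overring
  `R(g)` — finitely many — together with the image of `R(f)` in `R(g)/|D|·R(g)`, a finite set;
* `classNumber D := Nat.card (orbitsOfDisc D)` — the number `h(D)` of `GL₂(ℤ)`-orbits of
  discriminant `D` (BTT (22)), a genuine natural number for `D ≠ 0`.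

## References

* M. Bhargava, T. Taniguchi, F. Thorne, *Improved error estimates for the Davenport–Heilbronn
  theorems*, Math. Ann. 389 (2024) = arXiv:2107.12819, §2.4 (11)–(12), (22) [BhargavaTaniguchiThorne2023].
* H. Davenport, *On the class-number of binary cubic forms I, II*, J. London Math. Soc. 26 (1951)
  (the classical finiteness via reduction theory).
-/

namespace Literature.NumberTheory.CubicFields

open BinaryCubic RingOfForm

/-! ### Finitely many maximal orbits of bounded discriminant -/

/-- The orbits of maximal nondegenerate forms with `|Disc| ≤ B`. [folklore] -/
def maximalOrbits (B : ℕ) : Set (Set (BinaryCubic ℤ)) :=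
  {O | ∃ g : BinaryCubic ℤ, O = gl2zOrbit g ∧ IsMaximal g ∧ g.disc ≠ 0 ∧ g.disc.natAbs ≤ B}

/-- **There are only finitely many `GL₂(ℤ)`-orbits of maximal forms with `0 < |Disc| ≤ B`**:
the irreducible ones are the Davenport–Heilbronn orbits of the finitely many cubic fields with
`|Disc| ≤ B` (Hermite), the reducible ones correspond to the fundamental discriminants (and `1`)
in `[−B, B]`. [folklore] -/
theorem maximalOrbits_finite (B : ℕ) : (maximalOrbits B).Finite := by
  haveI h1 : Fact ((1 : ℤ) = 1 ∨ (1 : ℤ) = -1) := ⟨Or.inl rfl⟩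
  haveI h2 : Fact ((-1 : ℤ) = 1 ∨ (-1 : ℤ) = -1) := ⟨Or.inr rfl⟩
  refine (((dhOrbits_finite 1 ((B : ℝ) + 1)).union (dhOrbits_finite (-1) ((B : ℝ) + 1))).union
    ((negReducibleMaximalOrbits_finite (B + 1)).union (posReducibleMaximalOrbits_finite (B + 1)))).subset ?_
  rintro O ⟨g, rfl, hmax, hg0, hB⟩
  have hU : ∀ p : ℕ, p.Prime → g.MemU p := isMaximal_iff_memU.mp hmax
  have habs : (g.disc.natAbs : ℤ) = |g.disc| := Int.natCast_natAbs g.disc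
  have hB' : |g.disc| ≤ (B : ℤ) := by rw [← habs]; exact_mod_cast hB
  by_cases hirr : g.IsIrreducible
  · left
    rcases lt_or_gt_of_ne hg0 with hneg | hpos
    · right
      have h1 : 0 < -1 * g.disc := by linarith
      have h2 : -1 * g.disc < (B : ℤ) + 1 := by rw [abs_of_neg hneg] at hB'; linarith
      exact ⟨g, rfl, hirr, hU, h1, by exact_mod_cast h2⟩
    · left
      have h1 : 0 < 1 * g.disc := by linarith
      have h2 : 1 * g.disc < (B : ℤ) + 1 := by rw [abs_of_pos hpos] at hB'; linarith
      exact ⟨g, rfl, hirr, hU, h1, by exact_mod_cast h2⟩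
  · right
    rcases lt_or_gt_of_ne hg0 with hneg | hpos
    · left
      refine ⟨g, rfl, hmax, hirr, ?_, hneg⟩
      rw [abs_of_neg hneg] at hB'
      push_cast
      linarith
    · right
      refine ⟨g, rfl, hmax, hirr, hpos, ?_⟩
      rw [abs_of_pos hpos] at hB'
      push_cast
      linarith

/-! ### The orbits of given discriminant -/

/-- The set of `GL₂(ℤ)`-orbits of integral binary cubic forms of discriminant `D` (whose number is
`h(D)` in BTT (22)). [cite: BhargavaTaniguchiThorne2023, (22) (h(n) = number of GL₂(ℤ)-orbits of discriminant n)] -/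
def orbitsOfDisc (D : ℤ) : Set (Set (BinaryCubic ℤ)) :=
  {O | ∃ f : BinaryCubic ℤ, O = gl2zOrbit f ∧ f.disc = D}

/-- Reduction of coordinates modulo `M`: `x + yω + zθ ↦ (x, y, z) mod M`. [folklore] -/
def redMod (g : BinaryCubic ℤ) (M : ℕ) (P : RingOfForm g) : Fin 3 → ZMod M :=
  ![(P.x : ZMod M), (P.y : ZMod M), (P.z : ZMod M)]

/-- Elements with the same reduction differ by `M` times an element. [folklore] -/
theorem exists_eq_add_mul_of_redMod_eq {g : BinaryCubic ℤ} {M : ℕ} {P Q : RingOfForm g}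
    (h : redMod g M P = redMod g M Q) : ∃ W : RingOfForm g, P = Q + (M : RingOfForm g) * W := by
  have hx : (P.x : ZMod M) = Q.x := by simpa [redMod] using congrFun h 0
  have hy : (P.y : ZMod M) = Q.y := by simpa [redMod] using congrFun h 1
  have hz : (P.z : ZMod M) = Q.z := by simpa [redMod] using congrFun h 2
  rw [ZMod.intCast_eq_intCast_iff_dvd_sub] at hx hy hz
  obtain ⟨a, ha⟩ := hx
  obtain ⟨b, hb⟩ := hy
  obtain ⟨c, hc⟩ := hz
  refine ⟨⟨-a, -b, -c⟩, ?_⟩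
  ext <;> simp <;> linarith

/-- **A finite-index subring is determined by its reduction**: if `H = ψ(R(f)) ⊆ R(g)` contains
`M · R(g)` then `x ∈ H ⇔ (x mod M) ∈ (H mod M)`. [folklore] -/
theorem mem_range_iff_redMod_mem {f g : BinaryCubic ℤ} (ψ : RingOfForm f →+* RingOfForm g) {M : ℕ}
    (hM : ∀ y : RingOfForm g, (M : RingOfForm g) * y ∈ Set.range ψ) (x : RingOfForm g) :
    x ∈ Set.range ψ ↔ redMod g M x ∈ redMod g M '' Set.range ψ := by
  constructor
  · intro hx; exact ⟨x, hx, rfl⟩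
  · rintro ⟨h, hh, hred⟩
    obtain ⟨W, hW⟩ := exists_eq_add_mul_of_redMod_eq hred.symm
    obtain ⟨r, hr⟩ := hh
    obtain ⟨r', hr'⟩ := hM W
    exact ⟨r + r', by rw [map_add, hr, hr', ← hW]⟩

/-- Injective ring homomorphisms into `R(g)` with the same image have isomorphic sources. [folklore] -/
theorem nonempty_ringEquiv_of_range_eq {f f' g : BinaryCubic ℤ} {ψ : RingOfForm f →+* RingOfForm g}
    {ψ' : RingOfForm f' →+* RingOfForm g} (hψ : Function.Injective ψ) (hψ' : Function.Injective ψ')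
    (h : Set.range ψ = Set.range ψ') : Nonempty (RingOfForm f ≃+* RingOfForm f') := by
  have hr : ψ.range = ψ'.range := SetLike.coe_injective (by simpa using h)
  have e : RingOfForm f ≃+* ψ.range := RingEquiv.ofBijective ψ.rangeRestrict
    ⟨fun x y hxy => hψ (by simpa using congrArg Subtype.val hxy), RingHom.rangeRestrict_surjective ψ⟩
  have e' : RingOfForm f' ≃+* ψ'.range := RingEquiv.ofBijective ψ'.rangeRestrict
    ⟨fun x y hxy => hψ' (by simpa using congrArg Subtype.val hxy), RingHom.rangeRestrict_surjective ψ'⟩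
  exact ⟨(e.trans (RingEquiv.subringCongr hr)).trans e'.symm⟩

/-- The key comparison: two forms embedded (with `M · R ⊆` image) into the same ring `R(g)` with the
same reduction modulo `M` are `GL₂(ℤ)`-equivalent. [folklore] -/
theorem gl2zEquiv_of_redMod_image_eq {M : ℕ} {f f' g g' : BinaryCubic ℤ} (hg : g = g')
    (ψ : RingOfForm f →+* RingOfForm g) (ψ' : RingOfForm f' →+* RingOfForm g')
    (hψ : Function.Injective ψ) (hψ' : Function.Injective ψ')
    (hM : ∀ y, (M : RingOfForm g) * y ∈ Set.range ψ) (hM' : ∀ y, (M : RingOfForm g') * y ∈ Set.range ψ')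
    (hT : redMod g M '' Set.range ψ = redMod g' M '' Set.range ψ') : GL2ZEquiv f f' := by
  subst hg
  have hrange : Set.range ψ = Set.range ψ' := by
    ext x
    rw [mem_range_iff_redMod_mem ψ hM x, mem_range_iff_redMod_mem ψ' hM' x, hT]
  obtain ⟨e⟩ := nonempty_ringEquiv_of_range_eq hψ hψ' hrange
  exact GL2ZEquiv.of_ringEquiv e

/-- **Finiteness of `h(D)`**: for `D ≠ 0` there are only finitely many `GL₂(ℤ)`-orbits of integral
binary cubic forms of discriminant `D` (BTT 2023, §2.4: the coefficients `a^±(n)`, `h(n)` of the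
Shintani zeta functions are finite). Proof: the orbit of `f` is determined by the orbit of a maximal
overring `R(g) ⊇ R(f)` (finitely many, `maximalOrbits_finite`, as `Disc g ∣ D`) and by the image of
`R(f)` in the finite ring `R(g)/|D| R(g)`. [cite: BhargavaTaniguchiThorne2023, §2.4 (11)–(12) (finitely many GL₂(ℤ)-orbits of each discriminant)] -/
theorem orbitsOfDisc_finite {D : ℤ} (hD : D ≠ 0) : (orbitsOfDisc D).Finite := by
  classical
  set M : ℕ := D.natAbs with hM
  -- finitely many maximal orbits with `|Disc| ≤ |D|`, and a representative form for each
  have hfin := maximalOrbits_finite M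
  let Rep : maximalOrbits M → BinaryCubic ℤ := fun O => O.2.choose
  have hRep : ∀ O : maximalOrbits M, O.1 = gl2zOrbit (Rep O) := fun O => O.2.choose_spec.1
  haveI : Finite (maximalOrbits M) := hfin.to_subtype
  haveI : NeZero M := ⟨by rw [hM]; exact Int.natAbs_ne_zero.mpr hD⟩
  -- the datum attached to an orbit of discriminant `D`
  -- (1) a form `f` in the orbit
  have hf : ∀ O : orbitsOfDisc D, ∃ f : BinaryCubic ℤ, O.1 = gl2zOrbit f ∧ f.disc = D :=
    fun O => O.2
  let fO : orbitsOfDisc D → BinaryCubic ℤ := fun O => (hf O).choose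
  have hfO : ∀ O : orbitsOfDisc D, O.1 = gl2zOrbit (fO O) ∧ (fO O).disc = D := fun O => (hf O).choose_spec
  -- (2) a maximal overring and its orbit, an element of `maximalOrbits M`
  have hover : ∀ O : orbitsOfDisc D, ∃ g : BinaryCubic ℤ, IsMaximal g ∧
      ∃ φ : RingOfForm (fO O) →+* RingOfForm g, Function.Injective φ :=
    fun O => exists_isMaximal_overring (by rw [(hfO O).2]; exact hD)
  let gO : orbitsOfDisc D → BinaryCubic ℤ := fun O => (hover O).choose
  have hgO : ∀ O, IsMaximal (gO O) := fun O => (hover O).choose_spec.1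
  let φO : ∀ O : orbitsOfDisc D, RingOfForm (fO O) →+* RingOfForm (gO O) := fun O => (hover O).choose_spec.2.choose
  have hφO : ∀ O, Function.Injective (φO O) := fun O => (hover O).choose_spec.2.choose_spec
  have hmemMax : ∀ O : orbitsOfDisc D, gl2zOrbit (gO O) ∈ maximalOrbits M := by
    intro O
    have hdisc := disc_eq_detOnQuot_sq_mul (φO O) (hφO O)
    rw [(hfO O).2] at hdisc
    have hg0 : (gO O).disc ≠ 0 := fun h => hD (by rw [hdisc, h, mul_zero])
    refine ⟨gO O, rfl, hgO O, hg0, ?_⟩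
    rw [hM, hdisc, Int.natAbs_mul]
    exact Nat.le_mul_of_pos_left _ (Int.natAbs_pos.mpr (pow_ne_zero 2 (detOnQuot_ne_zero (hφO O))))
  let mO : orbitsOfDisc D → maximalOrbits M := fun O => ⟨gl2zOrbit (gO O), hmemMax O⟩
  -- (3) transport to the representative `Rep (mO O)` of that maximal orbit
  have hequiv : ∀ O : orbitsOfDisc D, GL2ZEquiv (gO O) (Rep (mO O)) := by
    intro O
    have h := hRep (mO O)
    exact gl2zOrbit_eq_iff.mp h
  have heO : ∀ O : orbitsOfDisc D, Nonempty (RingOfForm (gO O) ≃+* RingOfForm (Rep (mO O))) := fun O => by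
    obtain ⟨e⟩ := nonempty_ringEquiv_of_gl2zEquiv (hequiv O)
    exact ⟨e.symm⟩
  let ψO : ∀ O : orbitsOfDisc D, RingOfForm (fO O) →+* RingOfForm (Rep (mO O)) :=
    fun O => (heO O).some.toRingHom.comp (φO O)
  have hψO : ∀ O, Function.Injective (ψO O) := fun O => (heO O).some.injective.comp (hφO O)
  -- `M · R ⊆ ψ(R f)` (the index `N` has `N² Disc g = D`, so `N ∣ M = |D|`)
  have hMψ : ∀ (O : orbitsOfDisc D) (y : RingOfForm (Rep (mO O))),
      (M : RingOfForm (Rep (mO O))) * y ∈ Set.range (ψO O) := by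
    intro O y
    set N := detOnQuot (ψO O) with hN
    have hdisc := disc_eq_detOnQuot_sq_mul (ψO O) (hψO O)
    rw [(hfO O).2, ← hN] at hdisc
    have hMeq : (M : ℤ) = N * (N * ((Rep (mO O)).disc.natAbs : ℤ)) := by
      rw [hM, Int.natCast_natAbs, Int.natCast_natAbs, hdisc, abs_mul, abs_pow, sq_abs]; ring
    obtain ⟨r, hr⟩ := exists_eq_detOnQuot_mul (ψO O) (((N * ((Rep (mO O)).disc.natAbs : ℤ) : ℤ) : RingOfForm _) * y)
    refine ⟨r, ?_⟩
    rw [hr, ← hN, ← mul_assoc, ← Int.cast_mul, ← hMeq, Int.cast_natCast]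
  -- the datum and its injectivity
  let Φ : orbitsOfDisc D → (maximalOrbits M) × Set (Fin 3 → ZMod M) :=
    fun O => ⟨mO O, redMod (Rep (mO O)) M '' Set.range (ψO O)⟩
  refine Set.finite_coe_iff.mp (Finite.of_injective Φ ?_)
  intro O O' hOO'
  simp only [Φ, Prod.mk.injEq] at hOO'
  obtain ⟨hm, hT⟩ := hOO'
  apply Subtype.ext
  rw [(hfO O).1, (hfO O').1]
  exact gl2zOrbit_eq_iff.mpr (gl2zEquiv_of_redMod_image_eq (congrArg Rep hm) (ψO O) (ψO O') (hψO O) (hψO O')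
    (hMψ O) (hMψ O') hT)

/-- **`h(D)`**, the number of `GL₂(ℤ)`-orbits of integral binary cubic forms of discriminant `D`
(BTT 2023, (22); finite for `D ≠ 0` by `orbitsOfDisc_finite`). [cite: BhargavaTaniguchiThorne2023, (22) (h(n), the number of GL₂(ℤ)-orbits of discriminant n)] -/
noncomputable def classNumber (D : ℤ) : ℕ :=
  Nat.card (orbitsOfDisc D)

/-- For `D ≠ 0` the type of orbits of discriminant `D` is finite. [folklore] -/
theorem finite_orbitsOfDisc {D : ℤ} (hD : D ≠ 0) : Finite (orbitsOfDisc D) :=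
  (orbitsOfDisc_finite hD).to_subtype

/-- Example: the orbit of `f` is counted by `h(Disc f)`, so `h(Disc f) ≥ 1` for `Disc f ≠ 0`. [folklore] -/
theorem one_le_classNumber_disc {f : BinaryCubic ℤ} (h0 : f.disc ≠ 0) : 1 ≤ classNumber f.disc := by
  haveI := finite_orbitsOfDisc h0
  rw [classNumber, Nat.one_le_iff_ne_zero, ← Nat.pos_iff_ne_zero, Nat.card_pos_iff]
  exact ⟨⟨⟨gl2zOrbit f, f, rfl, rfl⟩⟩, inferInstance⟩

end Literature.NumberTheory.CubicFields
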